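import Summits.CriticalPhenomena.PercolationContinuityZ3.Theorems.PercNearOneGluingNoHeavyLowerTailRelayNeighbourhoodGluing
import HarnessLib

/-!
# `NoHeavyLowerTail` (stmt-CriticalPhenomena-4575), cumulative-isolation line — level 2 for observers with
# relay-only neighbourhoods (part 2 of 3: the glued base case)

With every pair at the observer `o` of weight `0` or `1`, `o` is glued to a set `Q ⊆ A` of relays and
otherwise isolated.  `RelayNbhd.base_case`: if `a ∈ A` is a level-2 champion of `G − o`
(`P⁰(|T_x| ≤ 2) ≤ P⁰(|T_a| ≤ 2)` for all `x ∈ A`, `P⁰` = the law with the pairs at `o` pinned closed), then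
`P(1 ≤ N ≤ 2) ≤ P(1 ≤ N ∧ |T_a| ≤ 2)`.  Cases: `Q = ∅` (`P(L) = 0`), `a ∈ Q` (`L ⊆ R` a.s.), `|Q| ≥ 3`
(`N ≥ 3` a.s.), `Q = {x}` (the champion inequality for `x`: a pendant observer does not change the relay
classes), `Q = {x,y}` (EXACTLY the merge lemma `mergeLemma_two`: `o`'s class is `T_x ∪ T_y`, `a`'s class is
unchanged when `a ↮ x, y`), transported to `G − o` by the formulas of part 1.
-/

namespace Summit.CriticalPhenomena.PercolationContinuityZ3.Theorems

open MeasureTheory Set Literature.Probability.LatticeModels Literature.Probability.Percolation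
open scoped Classical BigOperators

variable {n : ℕ}

namespace RelayNbhd

/-- **Base case** of `clusterSizeTransferTwo_of_relayNeighbourhood`: every pair at `o` has weight `0` or `1`
(`o` glued to a set `Q ⊆ A` of relays, isolated otherwise); level-2 champion `a` of `G − o`.
[cite: KozmaNitzan2024, §3.2 (p. 12) — analogue; VandenbergHaggstromKahn2005, Thm. 1.5 (p. 7)] -/
theorem base_case (w : Sym2 (Fin n) → unitInterval) (A : Finset (Fin n)) (o a : Fin n)
    (ho : o ∉ A) (ha : a ∈ A)
    (hrel : ∀ v : Fin n, v ≠ o → 0 < (w s(o, v) : ℝ) → v ∈ A)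
    (h01 : ∀ v : Fin n, v ≠ o → (w s(o, v) : ℝ) = 0 ∨ (w s(o, v) : ℝ) = 1)
    (hchamp : ∀ x ∈ A,
      (prodBernoulli (pinW w {e : Sym2 (Fin n) | o ∈ e ∧ ¬ e.IsDiag} ∅)).real
          {ω : BondConfig (Fin n) | (A.filter fun u => ω ∈ openConn x u).card ≤ 2} ≤
        (prodBernoulli (pinW w {e : Sym2 (Fin n) | o ∈ e ∧ ¬ e.IsDiag} ∅)).real
          {ω : BondConfig (Fin n) | (A.filter fun u => ω ∈ openConn a u).card ≤ 2}) :
    (prodBernoulli w).real {ω : BondConfig (Fin n) |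
        1 ≤ (A.filter fun x => ω ∈ openConn o x).card ∧
          (A.filter fun x => ω ∈ openConn o x).card ≤ 2} ≤
      (prodBernoulli w).real {ω : BondConfig (Fin n) |
        1 ≤ (A.filter fun x => ω ∈ openConn o x).card ∧
          (A.filter fun u => ω ∈ openConn a u).card ≤ 2} := by
  set μ := prodBernoulli w with hμ
  set μ0 := prodBernoulli (pinW w {e : Sym2 (Fin n) | o ∈ e ∧ ¬ e.IsDiag} ∅) with hμ0
  haveI hfinμ : IsProbabilityMeasure μ := by rw [hμ]; infer_instance
  haveI hfinμ0 : IsProbabilityMeasure μ0 := by rw [hμ0]; infer_instance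
  set L : Set (BondConfig (Fin n)) := {ω | 1 ≤ (A.filter fun x => ω ∈ openConn o x).card ∧
      (A.filter fun x => ω ∈ openConn o x).card ≤ 2} with hL
  set R : Set (BondConfig (Fin n)) := {ω | 1 ≤ (A.filter fun x => ω ∈ openConn o x).card ∧
      (A.filter fun u => ω ∈ openConn a u).card ≤ 2} with hR
  set Q : Finset (Fin n) := Finset.univ.filter (fun v : Fin n => v ≠ o ∧ (w s(o, v) : ℝ) = 1) with hQ
  have hQA : Q ⊆ A := by
    intro v hv
    obtain ⟨-, hvo, hv1⟩ := Finset.mem_filter.1 hv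
    exact hrel v hvo (by rw [hv1]; exact one_pos)
  have hao : a ≠ o := fun h => ho (h ▸ ha)
  -- the glued pairs are open almost surely under `μ`
  set Z : Set (BondConfig (Fin n)) := {ω | ∀ q ∈ Q, s(o, q) ∈ ω} with hZ
  have hZnull : μ.real Zᶜ = 0 := by
    have hsub : Zᶜ ⊆ ⋃ q ∈ Q, {ω : BondConfig (Fin n) | s(o, q) ∉ ω} := by
      intro ω hω
      simp only [hZ, Set.mem_compl_iff, Set.mem_setOf_eq, not_forall] at hω
      obtain ⟨q, hq, hnot⟩ := hω
      exact Set.mem_iUnion₂.2 ⟨q, hq, hnot⟩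
    have hle : μ.real Zᶜ ≤ ∑ q ∈ Q, μ.real {ω : BondConfig (Fin n) | s(o, q) ∉ ω} :=
      (measureReal_mono hsub (measure_ne_top _ _)).trans (measureReal_biUnion_finset_le Q _)
    have hsum : ∑ q ∈ Q, μ.real {ω : BondConfig (Fin n) | s(o, q) ∉ ω} = 0 := by
      refine Finset.sum_eq_zero fun q hq => ?_
      rw [hμ, prodBernoulli_real_setOf_notMem]
      have := (Finset.mem_filter.1 hq).2.2
      linarith
    exact le_antisymm (hle.trans hsum.le) measureReal_nonneg
  -- on `Z`, every `q ∈ Q` is in the relay class of `o`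
  have hQsub : ∀ ω ∈ Z, Q ⊆ A.filter fun x => ω ∈ openConn o x := by
    intro ω hω q hq
    refine Finset.mem_filter.2 ⟨hQA hq, ?_⟩
    have hqo : q ≠ o := (Finset.mem_filter.1 hq).2.1
    exact SimpleGraph.Adj.reachable ((openGraph_adj ω o q).2 ⟨hω q hq, hqo.symm⟩)
  -- Case `a ∈ Q`: `L ⊆ R` almost surely.
  by_cases haQ : a ∈ Q
  · refine (real_le_real_inter_of_null μ L Z hZnull).trans (measureReal_mono ?_ (measure_ne_top _ _))
    rintro ω ⟨⟨h1, h2⟩, hωZ⟩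
    refine ⟨h1, ?_⟩
    have hoa : ω ∈ (openConn o a : Set (BondConfig (Fin n))) := (Finset.mem_filter.1 (hQsub ω hωZ haQ)).2
    rw [MergeLemmaTwo.filter_eq_of_conn A hoa]
    exact h2
  -- Case `|Q| ≥ 3`: `L` is null.
  by_cases hQ3 : 3 ≤ Q.card
  · refine (real_le_real_inter_of_null μ L Z hZnull).trans ?_
    have hempty : L ∩ Z = ∅ := by
      ext ω
      simp only [Set.mem_inter_iff, Set.mem_empty_iff_false, iff_false, not_and]
      rintro ⟨-, h2⟩ hωZ
      have := Finset.card_le_card (hQsub ω hωZ)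
      omega
    rw [hempty, measureReal_empty]
    exact measureReal_nonneg
  -- Case `Q = ∅`: `o` is almost surely isolated.
  by_cases hQ0 : Q.card = 0
  · have hw : ∀ v : Fin n, v ≠ o → (w s(o, v) : ℝ) = 0 := by
      intro v hv
      rcases h01 v hv with h | h
      · exact h
      · exfalso
        have : v ∈ Q := Finset.mem_filter.2 ⟨Finset.mem_univ _, hv, h⟩
        rw [Finset.card_eq_zero] at hQ0
        rw [hQ0] at this
        exact Finset.notMem_empty v this
    rw [hL, hμ, MergeStability.real_L_eq_zero_of_isolated w A o 2 ho hw]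
    exact measureReal_nonneg
  -- weights at `o`: `1` on `Q`, `0` elsewhere
  have hw0 : ∀ v : Fin n, v ≠ o → v ∉ Q → w s(o, v) = 0 := by
    intro v hv hvQ
    rcases h01 v hv with h | h
    · exact Subtype.ext h
    · exact absurd (Finset.mem_filter.2 ⟨Finset.mem_univ _, hv, h⟩) hvQ
  have hw1 : ∀ v ∈ Q, w s(o, v) = 1 := fun v hv => Subtype.ext (Finset.mem_filter.1 hv).2.2
  -- the a.s. event "no open pair at o" under `μ0`
  set Z0 : Set (BondConfig (Fin n)) := {ω | ∀ v : Fin n, v ≠ o → s(o, v) ∉ ω} with hZ0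
  have hZ0null : μ0.real Z0ᶜ = 0 := real_compl_isolated_eq_zero w o
  -- pointwise description of `w` off the pairs of `Q`
  have hw_eq : ∀ e : Sym2 (Fin n), (∀ q ∈ Q, e ≠ s(o, q)) → w e = pinW w {e : Sym2 (Fin n) | o ∈ e ∧ ¬ e.IsDiag} ∅ e := by
    intro e he
    rw [pinW_apply]
    by_cases h : e ∈ {e : Sym2 (Fin n) | o ∈ e ∧ ¬ e.IsDiag}
    · obtain ⟨v, rfl⟩ := Sym2.mem_iff_exists.1 h.1
      have hvo : v ≠ o := by
        intro hv; apply h.2; rw [Sym2.mk_isDiag_iff]; exact hv.symm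
      have hvQ : v ∉ Q := fun hvQ => he v hvQ rfl
      rw [hw0 v hvo hvQ, if_pos h, if_neg (Set.notMem_empty _)]
    · rw [if_neg h]
  -- Case `|Q| = 1`
  by_cases hQ1 : Q.card = 1
  · obtain ⟨x, hQx⟩ := Finset.card_eq_one.1 hQ1
    have hxQ : x ∈ Q := by rw [hQx]; exact Finset.mem_singleton_self x
    have hxo : x ≠ o := (Finset.mem_filter.1 hxQ).2.1
    have hxA : x ∈ A := hQA hxQ
    have hxa : x ≠ a := fun h => haQ (h ▸ hxQ)
    have hweq : w = Function.update (pinW w {e : Sym2 (Fin n) | o ∈ e ∧ ¬ e.IsDiag} ∅) s(o, x) 1 := by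
      funext e
      by_cases he : e = s(o, x)
      · rw [he, Function.update_self]; exact hw1 x hxQ
      · rw [Function.update_of_ne he]
        refine hw_eq e fun q hq => ?_
        rw [hQx, Finset.mem_singleton] at hq
        rw [hq]; exact he
    have hμL : μ.real L = μ0.real ((fun ω : BondConfig (Fin n) => insert s(o, x) ω) ⁻¹' L) := by
      rw [hμ, hweq, real_update_wzero_one w hxo]
    have hμR : μ.real R = μ0.real ((fun ω : BondConfig (Fin n) => insert s(o, x) ω) ⁻¹' R) := by
      rw [hμ, hweq, real_update_wzero_one w hxo]
    -- on `Z0`: the class of `o` after gluing is the class of `x`; the class of `a` is unchanged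
    have hfilt_o : ∀ ω ∈ Z0, (A.filter fun u => insert s(o, x) ω ∈ (openConn o u : Set (BondConfig (Fin n)))) =
        A.filter fun u => ω ∈ (openConn x u : Set (BondConfig (Fin n))) := by
      intro ω hω
      ext u
      simp only [Finset.mem_filter, and_congr_right_iff]
      intro huA
      have huo : u ≠ o := fun h => ho (h ▸ huA)
      exact reachable_o_insert_iff_of_isolated hxo.symm hω huo
    have hfilt_a : ∀ ω ∈ Z0, (A.filter fun u => insert s(o, x) ω ∈ (openConn a u : Set (BondConfig (Fin n)))) =
        A.filter fun u => ω ∈ (openConn a u : Set (BondConfig (Fin n))) := by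
      intro ω hω
      ext u
      simp only [Finset.mem_filter, and_congr_right_iff]
      intro huA
      have huo : u ≠ o := fun h => ho (h ▸ huA)
      rw [show (insert s(o, x) ω ∈ (openConn a u : Set (BondConfig (Fin n)))) ↔
          (openGraph (insert s(o, x) ω)).Reachable a u from Iff.rfl,
        reachable_insert_iff_of_isolated hxo.symm hω hao huo]
      constructor
      · rintro (h | ⟨h1, h2⟩)
        · exact h
        · exact h1.trans h2
      · exact fun h => Or.inl h
    calc μ.real L = μ0.real ((fun ω : BondConfig (Fin n) => insert s(o, x) ω) ⁻¹' L) := hμL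
      _ ≤ μ0.real (((fun ω : BondConfig (Fin n) => insert s(o, x) ω) ⁻¹' L) ∩ Z0) :=
          real_le_real_inter_of_null μ0 _ Z0 hZ0null
      _ ≤ μ0.real {ω : BondConfig (Fin n) | (A.filter fun u => ω ∈ openConn x u).card ≤ 2} := by
          refine measureReal_mono ?_ (measure_ne_top _ _)
          rintro ω ⟨⟨-, h2⟩, hω⟩
          have h2' : (A.filter fun u => insert s(o, x) ω ∈
              (openConn o u : Set (BondConfig (Fin n)))).card ≤ 2 := h2
          rw [hfilt_o ω hω] at h2'
          exact h2'
      _ ≤ μ0.real {ω : BondConfig (Fin n) | (A.filter fun u => ω ∈ openConn a u).card ≤ 2} :=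
          hchamp x hxA
      _ ≤ μ0.real ({ω : BondConfig (Fin n) | (A.filter fun u => ω ∈ openConn a u).card ≤ 2} ∩ Z0) :=
          real_le_real_inter_of_null μ0 _ Z0 hZ0null
      _ ≤ μ0.real ((fun ω : BondConfig (Fin n) => insert s(o, x) ω) ⁻¹' R) := by
          refine measureReal_mono ?_ (measure_ne_top _ _)
          rintro ω ⟨h2, hω⟩
          have h2' : (A.filter fun u => ω ∈ (openConn a u : Set (BondConfig (Fin n)))).card ≤ 2 := h2
          refine ⟨?_, ?_⟩
          · refine Finset.one_le_card.2 ⟨x, Finset.mem_filter.2 ⟨hxA, ?_⟩⟩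
            exact SimpleGraph.Adj.reachable ((openGraph_adj _ o x).2 ⟨Set.mem_insert _ _, hxo.symm⟩)
          · change (A.filter fun u => insert s(o, x) ω ∈
              (openConn a u : Set (BondConfig (Fin n)))).card ≤ 2
            rw [hfilt_a ω hω]
            exact h2'
      _ = μ.real R := hμR.symm
  -- Case `|Q| = 2`: the merge lemma
  have hQ2 : Q.card = 2 := by omega
  obtain ⟨x, y, hxy, hQxy⟩ := Finset.card_eq_two.1 hQ2
  have hxQ : x ∈ Q := by rw [hQxy]; simp
  have hyQ : y ∈ Q := by rw [hQxy]; simp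
  have hxo : x ≠ o := (Finset.mem_filter.1 hxQ).2.1
  have hyo : y ≠ o := (Finset.mem_filter.1 hyQ).2.1
  have hxA : x ∈ A := hQA hxQ
  have hyA : y ∈ A := hQA hyQ
  have hax : a ≠ x := fun h => haQ (h ▸ hxQ)
  have hay : a ≠ y := fun h => haQ (h ▸ hyQ)
  have hweq : w = Function.update (Function.update (pinW w {e : Sym2 (Fin n) | o ∈ e ∧ ¬ e.IsDiag} ∅) s(o, x) 1) s(o, y) 1 := by
    funext e
    by_cases hey : e = s(o, y)
    · rw [hey, Function.update_self]; exact hw1 y hyQ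
    rw [Function.update_of_ne hey]
    by_cases hex : e = s(o, x)
    · rw [hex, Function.update_self]; exact hw1 x hxQ
    rw [Function.update_of_ne hex]
    refine hw_eq e fun q hq => ?_
    rw [hQxy, Finset.mem_insert, Finset.mem_singleton] at hq
    rcases hq with rfl | rfl
    · exact hex
    · exact hey
  set glue : BondConfig (Fin n) → BondConfig (Fin n) := fun ω => insert s(o, y) (insert s(o, x) ω)
    with hglue
  have hμS : ∀ S : Set (BondConfig (Fin n)), μ.real S = μ0.real {ω | glue ω ∈ S} := by
    intro S
    rw [hμ, hweq, real_update_wzero_one_one w hxo hyo hxy S]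
  -- on `Z0`: the class of `o` after the two gluings is `T_x ∪ T_y`
  have hconn_o : ∀ ω ∈ Z0, ∀ u : Fin n, u ≠ o →
      ((openGraph (glue ω)).Reachable o u ↔ ((openGraph ω).Reachable x u ∨ (openGraph ω).Reachable y u)) := by
    intro ω hω u huo
    simp only [hglue]
    rw [ChampionStability.reachable_insert_left_iff _ hyo.symm,
      reachable_o_insert_iff_of_isolated hxo.symm hω huo,
      reachable_insert_iff_of_isolated hxo.symm hω hyo huo]
    constructor
    · rintro (h | h | ⟨h1, h2⟩)
      · exact Or.inl h
      · exact Or.inr h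
      · exact Or.inl h2
    · rintro (h | h)
      · exact Or.inl h
      · exact Or.inr (Or.inl h)
  -- on `Z0 ∩ {a ↮ x} ∩ {a ↮ y}`: the class of `a` is unchanged by the two gluings
  have hconn_a : ∀ ω ∈ Z0, ¬ (openGraph ω).Reachable a x → ¬ (openGraph ω).Reachable a y →
      ∀ u : Fin n, u ≠ o →
      ((openGraph (glue ω)).Reachable a u ↔ (openGraph ω).Reachable a u) := by
    intro ω hω hax' hay' u huo
    have hao' : ¬ (openGraph (insert s(o, x) ω)).Reachable a o := by
      rw [ChampionStability.reachable_insert_to_left_iff ω hxo.symm]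
      rintro (h | h)
      · exact hao (eq_of_reachable_of_isolated hω h.symm)
      · exact hax' h
    have hay'' : ¬ (openGraph (insert s(o, x) ω)).Reachable a y := by
      rw [reachable_insert_iff_of_isolated hxo.symm hω hao hyo]
      rintro (h | ⟨h, -⟩)
      · exact hay' h
      · exact hax' h
    simp only [hglue]
    rw [ChampionStability.reachable_insert_iff_of_not _ hyo.symm hao' hay'',
      reachable_insert_iff_of_isolated hxo.symm hω hao huo]
    constructor
    · rintro (h | ⟨h, -⟩)
      · exact h
      · exact absurd h hax'
    · exact fun h => Or.inl h
  -- the merge lemma in `G − o`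
  have hML := mergeLemma_two n (pinW w {e : Sym2 (Fin n) | o ∈ e ∧ ¬ e.IsDiag} ∅) A a x y ha hxA hyA hax hay hxy (hchamp x hxA) (hchamp y hyA)
  calc μ.real L = μ0.real {ω | glue ω ∈ L} := hμS L
    _ ≤ μ0.real ({ω | glue ω ∈ L} ∩ Z0) := real_le_real_inter_of_null μ0 _ Z0 hZ0null
    _ ≤ μ0.real {ω : BondConfig (Fin n) |
          ∀ u ∈ A, u ≠ x → u ≠ y → ω ∉ openConn x u ∧ ω ∉ openConn y u} := by
        refine measureReal_mono ?_ (measure_ne_top _ _)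
        rintro ω ⟨⟨-, h2⟩, hω⟩ u huA hux huy
        have huo : u ≠ o := fun h => ho (h ▸ huA)
        -- the class of `o` in `glue ω` contains `x`, `y`; it has at most two elements
        have h2' : (A.filter fun v => glue ω ∈ (openConn o v : Set (BondConfig (Fin n)))).card ≤ 2 := h2
        have hxin : x ∈ A.filter fun v => glue ω ∈ (openConn o v : Set (BondConfig (Fin n))) :=
          Finset.mem_filter.2 ⟨hxA, (hconn_o ω hω x hxo).2 (Or.inl (SimpleGraph.Reachable.refl x))⟩
        have hyin : y ∈ A.filter fun v => glue ω ∈ (openConn o v : Set (BondConfig (Fin n))) :=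
          Finset.mem_filter.2 ⟨hyA, (hconn_o ω hω y hyo).2 (Or.inr (SimpleGraph.Reachable.refl y))⟩
        have hnot : u ∉ A.filter fun v => glue ω ∈ (openConn o v : Set (BondConfig (Fin n))) := by
          intro hu
          have hsub : ({x, y, u} : Finset (Fin n)) ⊆
              A.filter fun v => glue ω ∈ (openConn o v : Set (BondConfig (Fin n))) := by
            intro v hv
            simp only [Finset.mem_insert, Finset.mem_singleton] at hv
            rcases hv with rfl | rfl | rfl
            · exact hxin
            · exact hyin
            · exact hu
          have hcard : ({x, y, u} : Finset (Fin n)).card = 3 := by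
            rw [Finset.card_insert_of_notMem, Finset.card_pair (Ne.symm huy)]
            simp only [Finset.mem_insert, Finset.mem_singleton, not_or]
            exact ⟨hxy, Ne.symm hux⟩
          have := Finset.card_le_card hsub
          omega
        have hnot' : ¬ (openGraph (glue ω)).Reachable o u := by
          intro h; exact hnot (Finset.mem_filter.2 ⟨huA, h⟩)
        rw [hconn_o ω hω u huo, not_or] at hnot'
        exact hnot'
    _ ≤ μ0.real ({ω : BondConfig (Fin n) | (A.filter fun u => ω ∈ openConn a u).card ≤ 2} ∩
          (openConn x a)ᶜ ∩ (openConn y a)ᶜ) := hML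
    _ ≤ μ0.real (({ω : BondConfig (Fin n) | (A.filter fun u => ω ∈ openConn a u).card ≤ 2} ∩
          (openConn x a)ᶜ ∩ (openConn y a)ᶜ) ∩ Z0) := real_le_real_inter_of_null μ0 _ Z0 hZ0null
    _ ≤ μ0.real {ω | glue ω ∈ R} := by
        refine measureReal_mono ?_ (measure_ne_top _ _)
        rintro ω ⟨⟨⟨h2, hxa'⟩, hya'⟩, hω⟩
        have h2' : (A.filter fun u => ω ∈ (openConn a u : Set (BondConfig (Fin n)))).card ≤ 2 := h2
        have hax' : ¬ (openGraph ω).Reachable a x := fun h => hxa' h.symm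
        have hay' : ¬ (openGraph ω).Reachable a y := fun h => hya' h.symm
        refine ⟨?_, ?_⟩
        · refine Finset.one_le_card.2 ⟨x, Finset.mem_filter.2 ⟨hxA, ?_⟩⟩
          exact (hconn_o ω hω x hxo).2 (Or.inl (SimpleGraph.Reachable.refl x))
        · have heq : (A.filter fun u => glue ω ∈ (openConn a u : Set (BondConfig (Fin n)))) =
              A.filter fun u => ω ∈ (openConn a u : Set (BondConfig (Fin n))) := by
            ext u
            simp only [Finset.mem_filter, and_congr_right_iff]
            intro huA
            have huo : u ≠ o := fun h => ho (h ▸ huA)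
            exact hconn_a ω hω hax' hay' u huo
          change (A.filter fun u => glue ω ∈ (openConn a u : Set (BondConfig (Fin n)))).card ≤ 2
          rw [heq]
          exact h2'
    _ = μ.real R := (hμS R).symm

end RelayNbhd

end Summit.CriticalPhenomena.PercolationContinuityZ3.Theorems
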